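import Summits.CriticalPhenomena.PercolationContinuityZ3.Theorems.PercNearOneGluingNoHeavyLowerTailAntitheticOSClaim
import HarnessLib

/-!
# `NoHeavyLowerTail` (stmt-CriticalPhenomena-4575) — antithetic cluster pairs: the BULK CLASS LEMMA of THEOREM Λ (prim-hp-2 gen 45;
# HOME/THEOREM-Lambda-ears.md §2)

Support file (`--supports stmt-CriticalPhenomena-4575`, hull-port prover `prim-hp-2`, gen 45).  No definitions, no named facts, no sorries.

THEOREM Λ (cycle through `s`; marker set `Pm` at `b`, nested marker sets `Am ⊆ Am ∪ Em` at `a`): in a BULK class the two runs `P, Q ⊆ K`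
(clockwise / counter-clockwise; `K` the arc) see the marked vertex `a` at most once between them (`¬(a ◁ P ∧ a ◁ Q)`), likewise `b`; the lifts are
`ℓ_P X = X ∪ Pm·[b ◁ X]`, `ℓ_A X = X ∪ Am·[a ◁ X]`, `ℓ⁺ X = X ∪ Pm·[b ◁ X] ∪ (Am ∪ Em)·[a ◁ X]`, and the arc `K` sees what `P` or `Q` sees.
The class consists of the eight terms (`Δ(X,Y) = (F X − F Y)(G X − G Y)`)
  `Δ(ℓ⁺K, ∅) + Δ(ℓ_P K, ∅) + Δ(ℓ_A K, ∅) + Δ(K, ∅) + Δ(ℓ⁺P, Q) + Δ(ℓ⁺Q, P) + Δ(ℓ_P P, ℓ_A Q) + Δ(ℓ_P Q, ℓ_A P)`.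
* `Antithetic.LamQuad.class_nonneg` — this sum is `≥ 0` for all monotone `F, G`.  Proof: in 7 of the 9 lift patterns the four cross pairs are matched
  to the four arcs by containment (`Quad.arcs_pair` each); in the two WINDOW patterns (`a ◁ P, b ◁ Q` and `a ◁ Q, b ◁ P`) two pairs are paid by
  `Quad.arcs_pair` and the other two jointly by the arcs `ℓ_A K`, `ℓ⁺K` (`Quad.os_claim_sets`).
Abstract statement (any type, any sets with `P, Q ⊆ K`; the "is seen" conditions are propositions).  Machine-checked: HOME/code/gen45/lab/bulk_decomp.py
(the assignment), bulk_abstract.py (min over up-set pairs = 0 in every pattern).  [cite: VandenbergHaggstromKahn2005, §1 p. 3 (open cluster `C_s`)]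
-/

namespace Summit.CriticalPhenomena.PercolationContinuityZ3.Theorems

namespace Antithetic

namespace LamQuad

variable {α : Type*} {F G : Set α → ℝ}

/-- `Δ` is symmetric. [folklore] -/
theorem delta_symm (X Y : Set α) : (F X - F Y) * (G X - G Y) = (F Y - F X) * (G Y - G X) := by ring

/-- **Bulk class lemma of THEOREM Λ** (abstract form; `aP` = "`a` is seen by `P`", etc.). [this work] -/
theorem class_nonneg (hF : Monotone F) (hG : Monotone G) {P Q K Pm Am Em : Set α} (hP : P ⊆ K) (hQ : Q ⊆ K)
    (aP aQ bP bQ : Prop) [Decidable aP] [Decidable aQ] [Decidable bP] [Decidable bQ] (ha : ¬ (aP ∧ aQ)) (hb : ¬ (bP ∧ bQ)) :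
    0 ≤ (F (K ∪ (if bP ∨ bQ then Pm else ∅) ∪ (if aP ∨ aQ then Am ∪ Em else ∅)) - F ∅) *
          (G (K ∪ (if bP ∨ bQ then Pm else ∅) ∪ (if aP ∨ aQ then Am ∪ Em else ∅)) - G ∅) +
        (F (K ∪ (if bP ∨ bQ then Pm else ∅)) - F ∅) * (G (K ∪ (if bP ∨ bQ then Pm else ∅)) - G ∅) +
        (F (K ∪ (if aP ∨ aQ then Am else ∅)) - F ∅) * (G (K ∪ (if aP ∨ aQ then Am else ∅)) - G ∅) +
        (F K - F ∅) * (G K - G ∅) +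
        (F (P ∪ (if bP then Pm else ∅) ∪ (if aP then Am ∪ Em else ∅)) - F Q) *
          (G (P ∪ (if bP then Pm else ∅) ∪ (if aP then Am ∪ Em else ∅)) - G Q) +
        (F (Q ∪ (if bQ then Pm else ∅) ∪ (if aQ then Am ∪ Em else ∅)) - F P) *
          (G (Q ∪ (if bQ then Pm else ∅) ∪ (if aQ then Am ∪ Em else ∅)) - G P) +
        (F (P ∪ (if bP then Pm else ∅)) - F (Q ∪ (if aQ then Am else ∅))) *
          (G (P ∪ (if bP then Pm else ∅)) - G (Q ∪ (if aQ then Am else ∅))) +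
        (F (Q ∪ (if bQ then Pm else ∅)) - F (P ∪ (if aP then Am else ∅))) *
          (G (Q ∪ (if bQ then Pm else ∅)) - G (P ∪ (if aP then Am else ∅))) := by
  have k0 := Quad.arc_nonneg hF hG K
  have hAE : (Am : Set α) ⊆ Am ∪ Em := Set.subset_union_left
  -- generic inclusions
  have iPK : ∀ S T : Set α, P ∪ S ⊆ K ∪ S ∪ T := fun S T =>
    (Set.union_subset_union_left S hP).trans Set.subset_union_left
  have iQK : ∀ S T : Set α, Q ∪ S ⊆ K ∪ S ∪ T := fun S T =>
    (Set.union_subset_union_left S hQ).trans Set.subset_union_left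
  have iPK' : ∀ S T : Set α, P ∪ T ⊆ K ∪ S ∪ T := fun S T =>
    Set.union_subset (hP.trans (Set.subset_union_left.trans Set.subset_union_left)) Set.subset_union_right
  have iQK' : ∀ S T : Set α, Q ∪ T ⊆ K ∪ S ∪ T := fun S T =>
    Set.union_subset (hQ.trans (Set.subset_union_left.trans Set.subset_union_left)) Set.subset_union_right
  have jP : ∀ S : Set α, P ⊆ K ∪ S := fun S => hP.trans Set.subset_union_left
  have jQ : ∀ S : Set α, Q ⊆ K ∪ S := fun S => hQ.trans Set.subset_union_left
  have jP2 : ∀ S T : Set α, P ⊆ K ∪ S ∪ T := fun S T => (jP S).trans Set.subset_union_left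
  have jQ2 : ∀ S T : Set α, Q ⊆ K ∪ S ∪ T := fun S T => (jQ S).trans Set.subset_union_left
  have uP : ∀ S : Set α, P ∪ S ⊆ K ∪ S := fun S => Set.union_subset_union_left S hP
  have uQ : ∀ S : Set α, Q ∪ S ⊆ K ∪ S := fun S => Set.union_subset_union_left S hQ
  have vP : ∀ S T : Set α, P ∪ S ∪ T ⊆ K ∪ S ∪ T := fun S T => Set.union_subset_union_left T (uP S)
  have vQ : ∀ S T : Set α, Q ∪ S ∪ T ⊆ K ∪ S ∪ T := fun S T => Set.union_subset_union_left T (uQ S)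
  by_cases h1 : aP <;> by_cases h2 : aQ <;> by_cases h3 : bP <;> by_cases h4 : bQ
  · exact absurd ⟨h1, h2⟩ ha
  · exact absurd ⟨h1, h2⟩ ha
  · exact absurd ⟨h1, h2⟩ ha
  · exact absurd ⟨h1, h2⟩ ha
  · exact absurd ⟨h3, h4⟩ hb
  · simp only [if_pos h1, if_neg h2, if_pos h3, if_neg h4, if_pos (Or.inl h1 : aP ∨ aQ), if_pos (Or.inl h3 : bP ∨ bQ), Set.union_empty]
    -- a ◁ P, b ◁ P : matching
    nlinarith [Quad.arcs_pair hF hG (vP Pm (Am ∪ Em)) (jQ2 Pm (Am ∪ Em)), Quad.arcs_pair hF hG hQ hP,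
      Quad.arcs_pair hF hG (uP Pm) (jQ Pm), Quad.arcs_pair hF hG (jQ Am) (uP Am)]
  · simp only [if_pos h1, if_neg h2, if_neg h3, if_pos h4, if_pos (Or.inl h1 : aP ∨ aQ), if_pos (Or.inr h4 : bP ∨ bQ), Set.union_empty]
    -- a ◁ P, b ◁ Q : WINDOW — arcs_pair for (ℓ⁺Q, P) ⊆ ℓ_P K and (P, Q) ⊆ K; OS-claim with the arcs ℓ_A K, ℓ⁺K for the rest
    have w := Quad.os_claim_sets hF hG (X := P ∪ Am) (Xp := P ∪ (Am ∪ Em)) (Y := Q) (Yp := Q ∪ Pm) (S := K ∪ Am)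
      (Sp := K ∪ Pm ∪ (Am ∪ Em)) (Set.union_subset_union_right P hAE) Set.subset_union_left (uP Am) (jQ Am) (iPK' Pm (Am ∪ Em))
      (iQK Pm (Am ∪ Em))
    nlinarith [Quad.arcs_pair hF hG (uQ Pm) (jP Pm), Quad.arcs_pair hF hG hP hQ,
      delta_symm (F := F) (G := G) (P ∪ (Am ∪ Em)) Q, delta_symm (F := F) (G := G) (Q ∪ Pm) (P ∪ Am)]
  · simp only [if_pos h1, if_neg h2, if_neg h3, if_neg h4, if_pos (Or.inl h1 : aP ∨ aQ), if_neg (not_or.2 ⟨h3, h4⟩ : ¬ (bP ∨ bQ)), Set.union_empty]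
    -- a ◁ P, b unseen
    nlinarith [Quad.arcs_pair hF hG (uP (Am ∪ Em)) (jQ (Am ∪ Em)), Quad.arcs_pair hF hG hQ hP, Quad.arcs_pair hF hG hP hQ,
      Quad.arcs_pair hF hG (jQ Am) (uP Am), k0]
  · exact absurd ⟨h3, h4⟩ hb
  · simp only [if_neg h1, if_pos h2, if_pos h3, if_neg h4, if_pos (Or.inr h2 : aP ∨ aQ), if_pos (Or.inl h3 : bP ∨ bQ), Set.union_empty]
    -- a ◁ Q, b ◁ P : WINDOW (mirror)
    have w := Quad.os_claim_sets hF hG (X := Q ∪ Am) (Xp := Q ∪ (Am ∪ Em)) (Y := P) (Yp := P ∪ Pm) (S := K ∪ Am)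
      (Sp := K ∪ Pm ∪ (Am ∪ Em)) (Set.union_subset_union_right Q hAE) Set.subset_union_left (uQ Am) (jP Am) (iQK' Pm (Am ∪ Em))
      (iPK Pm (Am ∪ Em))
    nlinarith [Quad.arcs_pair hF hG (uP Pm) (jQ Pm), Quad.arcs_pair hF hG hQ hP,
      delta_symm (F := F) (G := G) (Q ∪ (Am ∪ Em)) P, delta_symm (F := F) (G := G) (P ∪ Pm) (Q ∪ Am)]
  · simp only [if_neg h1, if_pos h2, if_neg h3, if_pos h4, if_pos (Or.inr h2 : aP ∨ aQ), if_pos (Or.inr h4 : bP ∨ bQ), Set.union_empty]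
    -- a ◁ Q, b ◁ Q : matching
    nlinarith [Quad.arcs_pair hF hG (vQ Pm (Am ∪ Em)) (jP2 Pm (Am ∪ Em)), Quad.arcs_pair hF hG hP hQ,
      Quad.arcs_pair hF hG (uQ Pm) (jP Pm), Quad.arcs_pair hF hG (jP Am) (uQ Am)]
  · simp only [if_neg h1, if_pos h2, if_neg h3, if_neg h4, if_pos (Or.inr h2 : aP ∨ aQ), if_neg (not_or.2 ⟨h3, h4⟩ : ¬ (bP ∨ bQ)), Set.union_empty]
    -- a ◁ Q, b unseen
    nlinarith [Quad.arcs_pair hF hG (uQ (Am ∪ Em)) (jP (Am ∪ Em)), Quad.arcs_pair hF hG hP hQ, Quad.arcs_pair hF hG hQ hP,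
      Quad.arcs_pair hF hG (jP Am) (uQ Am), k0]
  · exact absurd ⟨h3, h4⟩ hb
  · simp only [if_neg h1, if_neg h2, if_pos h3, if_neg h4, if_neg (not_or.2 ⟨h1, h2⟩ : ¬ (aP ∨ aQ)), if_pos (Or.inl h3 : bP ∨ bQ), Set.union_empty]
    -- a unseen, b ◁ P
    nlinarith [Quad.arcs_pair hF hG (uP Pm) (jQ Pm), Quad.arcs_pair hF hG hQ hP, Quad.arcs_pair hF hG hP hQ,
      Quad.arcs_pair hF hG (jQ Pm) (uP Pm), k0]
  · simp only [if_neg h1, if_neg h2, if_neg h3, if_pos h4, if_neg (not_or.2 ⟨h1, h2⟩ : ¬ (aP ∨ aQ)), if_pos (Or.inr h4 : bP ∨ bQ), Set.union_empty]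
    -- a unseen, b ◁ Q
    nlinarith [Quad.arcs_pair hF hG (jP Pm) (uQ Pm), Quad.arcs_pair hF hG (uQ Pm) (jP Pm), Quad.arcs_pair hF hG hP hQ,
      Quad.arcs_pair hF hG hQ hP, k0]
  · simp only [if_neg h1, if_neg h2, if_neg h3, if_neg h4, if_neg (not_or.2 ⟨h1, h2⟩ : ¬ (aP ∨ aQ)), if_neg (not_or.2 ⟨h3, h4⟩ : ¬ (bP ∨ bQ)), Set.union_empty]
    -- nothing seen: THEOREM C's quadruple twice
    nlinarith [Quad.arcs_pair hF hG hP hQ, Quad.arcs_pair hF hG hQ hP, k0]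

end LamQuad

end Antithetic

end Summit.CriticalPhenomena.PercolationContinuityZ3.Theorems
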